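import Mathlib.RingTheory.MvPolynomial.WeightedHomogeneous
import Mathlib.RingTheory.Localization.AtPrime.Basic
import Mathlib.RingTheory.Localization.Away.Basic
import Literature.AlgebraicGeometry.Resolution.HasseSchmidtDerivatives
import Literature.AlgebraicGeometry.Resolution.DiffOpLocalizationExtend
import Literature.AlgebraicGeometry.Resolution.AdicOrderBasics
import HarnessLib

/-!
# A weighted-homogeneous form with a unit monomial `c·X^α` has order `≤ |α|` at EVERY prime (Hasse derivatives)

Topic: `Summits/ResolutionOfSingularities/ResolutionOfSingularities/Theorems`. Helper for the door item
`HypersurfaceCentreConstruction` (statement `stmt-ResolutionOfSingularities-19897`, route `WeightedInvariant`), line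
`local-engine` of res-L1-w43-plan-1 (L W4.3), ORDER (o33-a) «ν DOES NOT RISE UNDER AN ADMISSIBLE WEIGHTED MOVE»
(IOTA3-DESIGN v1 §5): the graded-ring half.  The exceptional fibre of the cobordant blow-up of a regular local ring
`S` along the weighted centre `(u₁^{1/w₁}, …, u_d^{1/w_d})` is `B/(t⁻¹) ≅ (S/(u))[X₁, …, X_d]` (res-type-098's
`LocalGameEFTPointMove.rho`, p507345), the saturated transform of `f` restricts there to the weighted initial form
`Φ = in_w(f)`, a weighted-homogeneous polynomial, and the order of the transform at a successor point `𝔫` is bounded by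
the order of `Φ` at the image prime (a local surjection does not decrease orders).  THIS FILE bounds the latter:

**Theorem (`not_mem_pow_succ_of_isUnit_coeff`, `adicOrder_le_degree_of_isUnit_coeff`).** Let `A` be a commutative
ring, `w : σ → ℕ` POSITIVE weights on finitely many variables, `Φ ∈ A[X_σ]` weighted-homogeneous, and `α` an exponent
whose coefficient `coeff α Φ` is a UNIT of `A`.  Then for every prime `𝔭` of `A[X_σ]`, `Φ/1 ∉ (𝔭 A[X]_𝔭)^{|α|+1}`,
i.e. `ord_𝔭 Φ ≤ |α|`.

Proof (characteristic-free): the Hasse–Schmidt derivative `D^{(α)}` (tree: `Resolution.hasseDeriv`, a differential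
operator of order `≤ |α|`, `isDiffOpLE_hasseDeriv`) sends `Φ` to the CONSTANT `coeff α Φ` — every other monomial `X^β`
of `Φ` has the same weight as `X^α`, so `α ≰ β` and `D^{(α)} X^β = 0` (`hasseDeriv_monomial_eq_zero_of_not_le`,
`hasseDeriv_monomial_self`, `hasseDeriv_eq_C_coeff`); if `s Φ ∈ 𝔭^{|α|+1}` with `s ∉ 𝔭`, extend `D^{(α)}` to the
localisation `A[X]_s` (tree: `exists_isDiffOpLE_extend`), where `Φ/1 ∈ (𝔭 A[X]_s)^{|α|+1}`, and apply the higher Leibniz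
estimate `IsDiffOpLE.apply_mem_pow_sub`: the unit `coeff α Φ` would lie in `𝔭 A[X]_s`, i.e. `𝔭 = ⊤`.

[OURS · L1 W4.3] Replaces the role of NO printed item; NOT a statement of the manuscript
[claim: Hironaka2017, status: under-review]. AI work, weaker than expert review.

## References

* A. Grothendieck, ÉGA IV₄, Publ. Math. IHÉS 32 (1967), §16.8 and Thm. 16.11.2 (differential operators, the `D_p`).
  [EGAIV4]
* O. Villamayor U., Rev. Mat. Iberoam. 24 (2008), §2.6, §4.1 (Taylor operators and the order criterion). [VillamayorU2008ReesDiff]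
* res-L1-w43-plan-1, `L/res-L1-w43-plan-1/IOTA3-DESIGN.md` v1 §5 ORDER (o33-a) (OURS, AI planning).
-/

noncomputable section

open MvPolynomial IsLocalRing
open Literature.AlgebraicGeometry.Resolution

set_option linter.dupNamespace false -- mandated namespace of this single-conjunct summit

namespace Summit.ResolutionOfSingularities.ResolutionOfSingularities.Theorems.WeightedInitialFormOrder

universe u v

variable {σ : Type u} {A : Type v} [CommRing A]

/-! ## Hasse–Schmidt derivatives of monomials -/

section Monomials

/-- `taylor (c X^β) = c · ∏_{i ∈ supp β} (x_i + u_i)^{β_i}`. [cite: VillamayorU2008ReesDiff, §2.6] -/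
theorem taylor_monomial (β : σ →₀ ℕ) (c : A) :
    taylor A (monomial β c) = C (C c) * β.prod fun i k => (C (X i) + X i) ^ k := by
  rw [taylor, aeval_monomial]
  rfl

/-- The `u_i`-degree of `taylor (c X^β)` is at most `β_i`. [cite: VillamayorU2008ReesDiff, §2.6] -/
theorem degreeOf_taylor_monomial_le [DecidableEq σ] (β : σ →₀ ℕ) (c : A) (i : σ) :
    degreeOf i (taylor A (monomial β c)) ≤ β i := by
  rcases subsingleton_or_nontrivial A with hA | hA
  · haveI : Subsingleton (MvPolynomial σ (MvPolynomial σ A)) := inferInstance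
    rw [Subsingleton.elim (taylor A (monomial β c)) 0, degreeOf_zero]
    exact Nat.zero_le _
  rw [taylor_monomial]
  refine le_trans (degreeOf_mul_le i _ _) ?_
  rw [degreeOf_C, zero_add, Finsupp.prod]
  refine le_trans (degreeOf_prod_le i _ _) ?_
  have hterm : ∀ j ∈ β.support, degreeOf i ((C (X j) + X j : MvPolynomial σ (MvPolynomial σ A)) ^ β j) ≤
      if j = i then β i else 0 := by
    intro j _
    refine le_trans (degreeOf_pow_le i _ _) ?_
    have h1 : degreeOf i (C (X j) + X j : MvPolynomial σ (MvPolynomial σ A)) ≤ if j = i then 1 else 0 := by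
      refine le_trans (degreeOf_add_le i _ _) ?_
      rw [degreeOf_C, degreeOf_X]
      split_ifs with h h' h'
      · exact le_rfl
      · exact absurd h.symm h'
      · exact absurd h'.symm h
      · exact le_rfl
    split_ifs with h
    · subst h
      simpa using Nat.mul_le_mul_left (β j) h1
    · rw [if_neg h] at h1
      have : degreeOf i (C (X j) + X j : MvPolynomial σ (MvPolynomial σ A)) = 0 := Nat.le_zero.mp h1
      rw [this, mul_zero]
  refine le_trans (Finset.sum_le_sum hterm) ?_
  rw [Finset.sum_ite_eq' β.support i]
  split_ifs <;> simp

/-- **`D^{(α)}(c X^β) = 0` unless `α ≤ β`** (the coefficient of `u^α` in `c ∏ (x_i + u_i)^{β_i}` vanishes as soon as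
some `α_i > β_i`). [cite: EGAIV4, Thm. 16.11.2 (16.11.2.1)] -/
theorem hasseDeriv_monomial_eq_zero_of_not_le [DecidableEq σ] {α β : σ →₀ ℕ} (h : ¬ α ≤ β) (c : A) :
    hasseDeriv A α (monomial β c) = 0 := by
  rw [hasseDeriv_apply]
  obtain ⟨i, hi⟩ : ∃ i, β i < α i := by
    by_contra hcon
    push Not at hcon
    exact h (fun i => hcon i)
  rw [← notMem_support_iff]
  intro hmem
  have hle := (degreeOf_le_iff.mp (degreeOf_taylor_monomial_le (A := A) β c i)) α hmem
  omega

/-- **`D^{(α)}(c X^α) = c`**: induction on the support of `α` with the higher Leibniz rule and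
`D^{(k e_i)}(x_i^k) = 1`. [cite: EGAIV4, Thm. 16.11.2 (16.11.2.1)] -/
theorem hasseDeriv_monomial_self [DecidableEq σ] (α : σ →₀ ℕ) (c : A) :
    hasseDeriv A α (monomial α c) = C c := by
  -- reduce to `c = 1`
  suffices h1 : hasseDeriv A α (monomial α (1 : A)) = 1 by
    have : monomial α c = C c * monomial α 1 := by rw [C_mul_monomial, mul_one]
    rw [this]
    have hlin : hasseDeriv A α (C c * monomial α 1) = C c * hasseDeriv A α (monomial α 1) := by
      rw [hasseDeriv_apply, hasseDeriv_apply, map_mul, taylor_C, coeff_C_mul]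
    rw [hlin, h1, mul_one]
  induction α using Finsupp.induction with
  | zero =>
    rw [hasseDeriv_zero_apply]
    rfl
  | single_add i k β hi hk ih =>
    -- `X^{k e_i + β} = x_i^k · X^β`
    have hsplit : (monomial (Finsupp.single i k + β) (1 : A)) = X i ^ k * monomial β 1 := by
      rw [X_pow_eq_monomial, monomial_mul, one_mul]
    have hXi : hasseDeriv A (Finsupp.single i k) (X i ^ k : MvPolynomial σ A) = 1 := by
      rw [hasseDeriv_X_pow, Nat.choose_self, Nat.sub_self, pow_zero, mul_one, Nat.cast_one]
    -- only the splitting `(k e_i, β)` contributes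
    have hvan : ∀ p ∈ Finset.antidiagonal (Finsupp.single i k + β), p ≠ (Finsupp.single i k, β) →
        hasseDeriv A p.1 (X i ^ k : MvPolynomial σ A) * hasseDeriv A p.2 (monomial β (1 : A)) = 0 := by
      rintro ⟨γ, δ⟩ hγδ hne
      rw [Finset.mem_antidiagonal] at hγδ
      by_cases hγ : γ ≤ Finsupp.single i k
      · have hδ : ¬ δ ≤ β := by
          intro hδ
          apply hne
          have h1 : γ = Finsupp.single i k := by
            refine le_antisymm hγ fun j => ?_
            have h' := congrArg (fun f => f j) hγδ
            simp only [Finsupp.coe_add, Pi.add_apply] at h'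
            have := hδ j
            omega
          have h2 : δ = β := by
            rw [h1] at hγδ
            exact add_left_cancel hγδ
          rw [h1, h2]
        show hasseDeriv A γ (X i ^ k) * hasseDeriv A δ (monomial β 1) = 0
        rw [hasseDeriv_monomial_eq_zero_of_not_le hδ, mul_zero]
      · show hasseDeriv A γ (X i ^ k) * hasseDeriv A δ (monomial β 1) = 0
        rw [X_pow_eq_monomial, hasseDeriv_monomial_eq_zero_of_not_le hγ, zero_mul]
    have hmem : (Finsupp.single i k, β) ∈ Finset.antidiagonal (Finsupp.single i k + β) :=
      Finset.mem_antidiagonal.mpr (rfl : Finsupp.single i k + β = Finsupp.single i k + β)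
    rw [hsplit, hasseDeriv_mul, Finset.sum_eq_single (Finsupp.single i k, β) hvan (fun h => absurd hmem h)]
    show hasseDeriv A (Finsupp.single i k) (X i ^ k) * hasseDeriv A β (monomial β 1) = 1
    rw [hXi, one_mul, ih]

end Monomials

/-! ## Weighted-homogeneous forms: `D^{(α)} Φ` is the constant `coeff α Φ` -/

section Weighted

variable {w : σ → ℕ}

/-- With POSITIVE weights, `weight γ = 0` forces `γ = 0`. [folklore] -/
theorem eq_zero_of_weight_eq_zero (hw : ∀ i, 0 < w i) {γ : σ →₀ ℕ} (h : Finsupp.weight w γ = 0) : γ = 0 := by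
  ext i
  by_contra hi
  have := Finsupp.le_weight w (hw i).ne' γ
  rw [h] at this
  exact hi (Nat.le_zero.mp this)

/-- Two comparable exponents of the same (positive) weight are equal. [folklore] -/
theorem eq_of_le_of_weight_eq (hw : ∀ i, 0 < w i) {α β : σ →₀ ℕ} (hle : α ≤ β)
    (h : Finsupp.weight w α = Finsupp.weight w β) : α = β := by
  obtain ⟨γ, rfl⟩ := exists_add_of_le hle
  have hγ : Finsupp.weight w γ = 0 := by
    have := h
    rw [map_add] at this
    omega
  rw [eq_zero_of_weight_eq_zero hw hγ, add_zero]

/-- **`D^{(α)} Φ = coeff α Φ` (a constant) for `Φ` weighted-homogeneous of the weight of `α`, positive weights**: every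
other monomial `X^β` of `Φ` has the weight of `X^α`, hence `α ≰ β` and `D^{(α)} X^β = 0`.
[cite: VillamayorU2008ReesDiff, §2.6] -/
theorem hasseDeriv_eq_C_coeff [DecidableEq σ] (hw : ∀ i, 0 < w i) {Φ : MvPolynomial σ A} {n : ℕ}
    (hΦ : Φ.IsWeightedHomogeneous w n) {α : σ →₀ ℕ} (hα : Finsupp.weight w α = n) :
    hasseDeriv A α Φ = C (coeff α Φ) := by
  conv_lhs => rw [Φ.as_sum]
  rw [map_sum]
  by_cases hmem : α ∈ Φ.support
  · rw [Finset.sum_eq_single α]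
    · exact hasseDeriv_monomial_self α _
    · intro β hβ hne
      refine hasseDeriv_monomial_eq_zero_of_not_le (fun hle => hne ?_) _
      exact (eq_of_le_of_weight_eq hw hle (by rw [hα, hΦ (mem_support_iff.mp hβ)])).symm
    · exact fun h => absurd hmem h
  · rw [notMem_support_iff.mp hmem, C_0]
    refine Finset.sum_eq_zero fun β hβ => ?_
    refine hasseDeriv_monomial_eq_zero_of_not_le (fun hle => hmem ?_) _
    rwa [eq_of_le_of_weight_eq hw hle (by rw [hα, hΦ (mem_support_iff.mp hβ)])]

end Weighted

/-! ## The order bound at every prime -/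

section OrderBound

variable [DecidableEq σ] {w : σ → ℕ}

/-- **A weighted-homogeneous form with a UNIT coefficient at `X^α` does not lie in `(𝔭 A[X]_𝔭)^{|α|+1}` for any prime
`𝔭`** — its `𝔭`-adic order is at most `|α|`.  Hasse derivative `D^{(α)}` (order `≤ |α|`), extended to `A[X]_s` for a
denominator `s ∉ 𝔭`, sends `Φ` to the unit `coeff α Φ` while lowering the `𝔭`-adic order by at most `|α|`.
[cite: EGAIV4, §16.8 (Prop. 16.8.8) and Thm. 16.11.2] -/
theorem not_mem_pow_succ_of_isUnit_coeff (hw : ∀ i, 0 < w i) {Φ : MvPolynomial σ A} {n : ℕ}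
    (hΦ : Φ.IsWeightedHomogeneous w n) {α : σ →₀ ℕ} (hc : IsUnit (coeff α Φ))
    (𝔭 : Ideal (MvPolynomial σ A)) [h𝔭 : 𝔭.IsPrime] :
    algebraMap (MvPolynomial σ A) (Localization.AtPrime 𝔭) Φ ∉
      maximalIdeal (Localization.AtPrime 𝔭) ^ (α.degree + 1) := by
  -- the base ring is nontrivial (a prime ideal is proper)
  have hP01 : (0 : MvPolynomial σ A) ≠ 1 := fun h01 =>
    h𝔭.ne_top ((Ideal.eq_top_iff_one 𝔭).mpr (h01 ▸ 𝔭.zero_mem))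
  haveI : Nontrivial A := ⟨⟨0, 1, fun h => hP01 (by rw [← C_0, h, C_1])⟩⟩
  have hα : Finsupp.weight w α = n := hΦ hc.ne_zero
  intro hmem
  -- Step 1: a denominator `t ∉ 𝔭` with `t Φ ∈ 𝔭^{|α|+1}`
  rw [← Localization.AtPrime.map_eq_maximalIdeal, ← Ideal.map_pow] at hmem
  obtain ⟨⟨⟨y, hy⟩, ⟨s, hs⟩⟩, hys⟩ :=
    (IsLocalization.mem_map_algebraMap_iff 𝔭.primeCompl (Localization.AtPrime 𝔭)).mp hmem
  simp only at hys
  rw [← map_mul] at hys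
  obtain ⟨⟨c, hc'⟩, hcc⟩ := (IsLocalization.eq_iff_exists 𝔭.primeCompl (Localization.AtPrime 𝔭)).mp hys
  simp only at hcc
  set t := c * s with ht
  have htmem : t ∉ 𝔭 := fun h => (h𝔭.mem_or_mem h).elim (fun h' => hc' h') (fun h' => hs h')
  have htΦ : t * Φ ∈ 𝔭 ^ (α.degree + 1) := by
    have : t * Φ = c * (Φ * s) := by rw [ht]; ring
    rw [this, hcc]
    exact Ideal.mul_mem_left _ _ hy
  -- Step 2: in `B = A[X]_t`, `Φ/1 ∈ (𝔭 B)^{|α|+1}`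
  let B := Localization.Away t
  have hΦB : algebraMap (MvPolynomial σ A) B Φ ∈ (𝔭.map (algebraMap (MvPolynomial σ A) B)) ^ (α.degree + 1) := by
    have h1 : algebraMap (MvPolynomial σ A) B (t * Φ) ∈
        (𝔭.map (algebraMap (MvPolynomial σ A) B)) ^ (α.degree + 1) := by
      rw [← Ideal.map_pow]
      exact Ideal.mem_map_of_mem _ htΦ
    rw [map_mul] at h1
    exact (Ideal.unit_mul_mem_iff_mem _ (IsLocalization.Away.algebraMap_isUnit t)).mp h1
  -- Step 3: extend `D^{(α)}` to `B` and apply the higher Leibniz estimate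
  obtain ⟨D', hD', hD'ext⟩ := exists_isDiffOpLE_extend A (B := B) t (isDiffOpLE_hasseDeriv A α.degree α le_rfl)
  have h4 := IsDiffOpLE.apply_mem_pow_sub (𝔭.map (algebraMap (MvPolynomial σ A) B)) (α.degree + 1) hD' hΦB
  rw [hD'ext, hasseDeriv_eq_C_coeff hw hΦ hα, Nat.add_sub_cancel_left, pow_one] at h4
  -- Step 4: `(C c)/1 ∈ 𝔭 B` forces the unit `C c` into `𝔭`
  obtain ⟨⟨⟨y', hy'⟩, ⟨s', hs'⟩⟩, e⟩ := (IsLocalization.mem_map_algebraMap_iff (Submonoid.powers t) B).mp h4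
  simp only at e
  rw [← map_mul] at e
  obtain ⟨⟨c'', hc''⟩, e'⟩ := (IsLocalization.eq_iff_exists (Submonoid.powers t) B).mp e
  simp only at e'
  have hpow : ∀ {x : MvPolynomial σ A}, x ∈ Submonoid.powers t → x ∉ 𝔭 := by
    rintro x ⟨m, rfl⟩ hx
    exact htmem (h𝔭.mem_of_pow_mem m hx)
  have hmem𝔭 : c'' * (C (coeff α Φ) * s') ∈ 𝔭 := by
    rw [e']
    exact Ideal.mul_mem_left _ _ hy'
  rcases h𝔭.mem_or_mem hmem𝔭 with h | h
  · exact hpow hc'' h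
  rcases h𝔭.mem_or_mem h with h | h
  · exact h𝔭.ne_top (Ideal.eq_top_of_isUnit_mem _ h (hc.map C))
  · exact hpow hs' h

/-- **`ord_𝔭 Φ ≤ |α|`** at every prime `𝔭` of `A[X]`, for `Φ` weighted-homogeneous (positive weights) with a unit
coefficient at `X^α`. [cite: EGAIV4, Thm. 16.11.2] -/
theorem adicOrder_le_degree_of_isUnit_coeff (hw : ∀ i, 0 < w i) {Φ : MvPolynomial σ A} {n : ℕ}
    (hΦ : Φ.IsWeightedHomogeneous w n) {α : σ →₀ ℕ} (hc : IsUnit (coeff α Φ))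
    (𝔭 : Ideal (MvPolynomial σ A)) [𝔭.IsPrime] :
    adicOrder (algebraMap (MvPolynomial σ A) (Localization.AtPrime 𝔭) Φ) ≤ (α.degree : ℕ∞) :=
  (adicOrder_le_iff _ _).mpr (not_mem_pow_succ_of_isUnit_coeff hw hΦ hc 𝔭)

end OrderBound

end Summit.ResolutionOfSingularities.ResolutionOfSingularities.Theorems.WeightedInitialFormOrder
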